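import Literature.NumberTheory.Transcendental.KZDilationBakerSectorComplexPrep
import Literature.NumberTheory.Transcendental.KZDilationLogGeneratorsNash
import Literature.NumberTheory.Transcendental.KZDilationLogSectorLift
import Literature.NumberTheory.Transcendental.KZDilationArgHalving
import HarnessLib

/-!
# The complex Baker sector of the dilation pencil, III: the two lifts along an exact relation

Pole data `(p_k, q_k)` real algebraic with the slit condition `0 < 1 − p_k x ∨ q_k x ≠ 0` on
`(a,b) ⊇ [0,1]`; `m_k(x) = (1 − p_k x)² + (q_k x)²`, `w_k(x) = 1 − (p_k + iq_k)x`.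
* `exists_kernel_logPart`: for RATIONAL `e_k` with the exact relation `Σ_k e_k log m_k(1) = 0`, the
  dilation function of `h = Σ_k e_k (−p_k + (p_k²+q_k²)x)/m_k = (log Q)'`, `Q = Π_k m_k^{e_k/2}`
  (`Q(0) = Q(1) = 1`), lies in `(ϖ − 1)·D'` with one Nash kernel (logarithmic sector,
  `KZ.dilationLogSector_lift`).
* `exists_kernel_argPart`: for RATIONAL `f_k` with the exact relation `Σ_k f_k arg w_k(1) = 0`, the
  dilation function of `ψ = Σ_k f_k (−q_k/m_k) = (Σ_k f_k arg w_k)'` lies in `(ϖ − 1)·D'` with one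
  Nash kernel: clear denominators (`F = D·f ∈ ℤ`), take the small Nash representative `T` with
  `arctan T = (Σ_k F_k arg w_k)/2^{m+1}` (`KZDilationArgHalving`), so `T(0) = T(1) = 0` and
  `ψ = (2^{m+1}/D)·(arctan T)'`, and apply the arctangent sector (`KZ.dilationArctanSector_lift`).

Everything is proved; no `def`, no named fact.

## References
* M. Kontsevich, D. Zagier, *Periods* (2001), §1.2. [`KontsevichZagier2001`]
-/

noncomputable section

open Set MeasureTheory Filter MvPolynomial Complex
open scoped BigOperators Topology Real
open Literature.ModelTheory.ExponentialFields

namespace Literature.NumberTheory.Transcendental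

namespace KZ.BakerSectorComplex

variable {a b : ℝ} {A : ℕ} {p q : Fin A → ℝ}

/-- **The logarithmic part.** See the module docstring. [cite: KontsevichZagier2001, §1.2] -/
theorem exists_kernel_logPart (ha : a < 0) (hb : 1 < b)
    (hI : IsSemialgebraic ℚ {t : Fin 1 → ℝ | t 0 ∈ Ioo a b})
    (hp : ∀ k, IsAlgebraic ℚ (p k)) (hq : ∀ k, IsAlgebraic ℚ (q k))
    (hslit : ∀ k, ∀ x ∈ Ioo a b, 0 < 1 - p k * x ∨ q k * x ≠ 0) (e : Fin A → ℚ)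
    (hrel : ∑ k, (e k : ℝ) * Real.log ((1 - p k * 1) ^ 2 + (q k * 1) ^ 2) = 0) :
    ∃ (K : (Fin 2 → ℝ) → ℝ) (V : Set (Fin 2 → ℝ)), IsOpen V ∧
      (∀ ϖ ∈ Icc (0:ℝ) 1, ∀ x ∈ Set.pi Set.univ (fun _ : Fin 1 => Icc (0:ℝ) 1),
        Matrix.vecCons ϖ x ∈ V) ∧
      IsSemialgebraicFunOn ℚ V K ∧ AnalyticOnNhd ℝ K V ∧
      ∀ ϖ ∈ Icc (0:ℝ) 1,
        (∫ z in Set.pi Set.univ (fun _ : Fin 1 => Icc (0:ℝ) 1),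
            ∑ k, (e k : ℝ) * ((-p k + (p k ^ 2 + q k ^ 2) * ((ϖ • z) 0)) /
              ((1 - p k * ((ϖ • z) 0)) ^ 2 + (q k * ((ϖ • z) 0)) ^ 2))) =
          (ϖ - 1) * ∫ y in Set.pi Set.univ (fun _ : Fin 1 => Icc (0:ℝ) 1),
            K (Matrix.vecCons ϖ (ϖ • y)) := by
  have hb0 : (0:ℝ) < b := zero_lt_one.trans hb
  have h0I : (0:ℝ) ∈ Ioo a b := ⟨ha, hb0⟩
  have h1I : (1:ℝ) ∈ Ioo a b := ⟨ha.trans zero_lt_one, hb⟩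
  -- the positive Nash bases `m_k` and the generator `Q = Π m_k^{e_k/2}`
  set u : Fin A → ℝ → ℝ := fun k x => (1 - p k * x) ^ 2 + (q k * x) ^ 2 with hu
  set u' : Fin A → ℝ → ℝ := fun k x => 2 * (-p k + (p k ^ 2 + q k ^ 2) * x) with hu'
  have hpos : ∀ k, ∀ x ∈ Ioo a b, 0 < u k x := fun k x hx => m_pos (hslit k x hx)
  have hder : ∀ k, ∀ x ∈ Ioo a b, HasDerivAt (u k) (u' k x) x := fun k x _ => hasDerivAt_m (p k) (q k) x
  have hua : ∀ k, ∀ x ∈ Ioo a b, AnalyticAt ℝ (u k) x := fun k x _ => by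
    simp only [hu]
    exact ((analyticAt_const.sub (analyticAt_const.mul analyticAt_id)).pow 2).add
      ((analyticAt_const.mul analyticAt_id).pow 2)
  have hus : ∀ k, IsSemialgebraicFunOn ℚ {t : Fin 1 → ℝ | t 0 ∈ Ioo a b} (fun t => u k (t 0)) :=
    fun k => isSemialgebraicFunOn_m hI (hp k) (hq k)
  set N : Fin A → ℚ := fun k => e k / 2 with hN
  set Q : ℝ → ℝ := fun x => ∏ k, u k x ^ ((N k : ℚ) : ℝ) with hQ
  set h : ℝ → ℝ := fun x => ∑ k, (e k : ℝ) * ((-p k + (p k ^ 2 + q k ^ 2) * x) /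
    ((1 - p k * x) ^ 2 + (q k * x) ^ 2)) with hh
  have hQder : ∀ x ∈ Ioo a b, HasDerivAt Q (h x * Q x) x := by
    intro x hx
    have hd := KZ.DilationLogSector.hasDerivAt_nashProd hpos hder N hx
    refine hd.congr_deriv ?_
    simp only [hQ]
    congr 1
    simp only [hh, hN, hu, hu']
    refine Finset.sum_congr rfl fun k _ => ?_
    have hm : (1 - p k * x) ^ 2 + (q k * x) ^ 2 ≠ 0 := (m_pos (hslit k x hx)).ne'
    push_cast
    field_simp
  have hQ01 : Q 1 = Q 0 := by
    have hQ0 : Q 0 = 1 := by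
      refine KZ.DilationLogSector.nashProd_eq_one_of hpos N h0I ?_
      simp [hu]
    have hQ1 : Q 1 = 1 := by
      refine KZ.DilationLogSector.nashProd_eq_one_of hpos N h1I ?_
      have : ∑ k, ((N k : ℚ) : ℝ) * Real.log (u k 1) =
          2⁻¹ * ∑ k, (e k : ℝ) * Real.log ((1 - p k * 1) ^ 2 + (q k * 1) ^ 2) := by
        rw [Finset.mul_sum]
        refine Finset.sum_congr rfl fun k _ => ?_
        simp only [hN, hu]
        push_cast
        ring
      rw [this, hrel, mul_zero]
    rw [hQ0, hQ1]
  obtain ⟨K, V, hVo, hVc, hKs, hKa, hid⟩ := KZ.dilationLogSector_lift ha hb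
    (KZ.DilationLogSector.isSemialgebraicFunOn_nashProd hpos hI hus N) (fun x hx => KZ.DilationLogSector.analyticAt_nashProd hpos hua N hx)
    (fun x hx => KZ.DilationLogSector.nashProd_pos hpos N hx) hQder hQ01
  exact ⟨K, V, hVo, hVc, hKs, hKa, fun ϖ hϖ => by simpa only [hh] using hid ϖ hϖ⟩

/-- Clearing denominators of a rational vector: `F_k := num(f_k) · (D / den(f_k))`,
`D = Π_k den(f_k)`, satisfies `F_k = D · f_k`. [folklore] -/
theorem exists_int_mul_eq (f : Fin A → ℚ) :
    ∃ (D : ℕ) (F : Fin A → ℤ), 0 < D ∧ ∀ k, ((F k : ℤ) : ℝ) = (D : ℝ) * (f k : ℝ) := by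
  classical
  refine ⟨∏ k, (f k).den, fun k => (f k).num * (((∏ k', (f k').den) / (f k).den : ℕ) : ℤ),
    Finset.prod_pos fun k _ => (f k).den_pos, fun k => ?_⟩
  have hdvd : (f k).den ∣ ∏ k', (f k').den := Finset.dvd_prod_of_mem _ (Finset.mem_univ k)
  have hden : ((f k).den : ℝ) ≠ 0 := by exact_mod_cast (f k).den_pos.ne'
  rw [Int.cast_mul, Int.cast_natCast, Nat.cast_div hdvd hden, Rat.cast_def]
  field_simp

/-- **The argument part.** See the module docstring. [cite: KontsevichZagier2001, §1.2] -/
theorem exists_kernel_argPart (ha : a < 0) (hb : 1 < b)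
    (hI : IsSemialgebraic ℚ {t : Fin 1 → ℝ | t 0 ∈ Ioo a b})
    (hp : ∀ k, IsAlgebraic ℚ (p k)) (hq : ∀ k, IsAlgebraic ℚ (q k))
    (hslit : ∀ k, ∀ x ∈ Ioo a b, 0 < 1 - p k * x ∨ q k * x ≠ 0) (f : Fin A → ℚ)
    (hrel : ∑ k, (f k : ℝ) * Complex.arg ((1 : ℂ) - ((p k : ℂ) + (q k : ℂ) * I) * ((1:ℝ) : ℂ)) = 0) :
    ∃ (K : (Fin 2 → ℝ) → ℝ) (V : Set (Fin 2 → ℝ)), IsOpen V ∧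
      (∀ ϖ ∈ Icc (0:ℝ) 1, ∀ x ∈ Set.pi Set.univ (fun _ : Fin 1 => Icc (0:ℝ) 1),
        Matrix.vecCons ϖ x ∈ V) ∧
      IsSemialgebraicFunOn ℚ V K ∧ AnalyticOnNhd ℝ K V ∧
      ∀ ϖ ∈ Icc (0:ℝ) 1,
        (∫ z in Set.pi Set.univ (fun _ : Fin 1 => Icc (0:ℝ) 1),
            ∑ k, (f k : ℝ) * (-q k / ((1 - p k * ((ϖ • z) 0)) ^ 2 + (q k * ((ϖ • z) 0)) ^ 2))) =
          (ϖ - 1) * ∫ y in Set.pi Set.univ (fun _ : Fin 1 => Icc (0:ℝ) 1),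
            K (Matrix.vecCons ϖ (ϖ • y)) := by
  classical
  have hb0 : (0:ℝ) < b := zero_lt_one.trans hb
  have h0I : (0:ℝ) ∈ Ioo a b := ⟨ha, hb0⟩
  have h1I : (1:ℝ) ∈ Ioo a b := ⟨ha.trans zero_lt_one, hb⟩
  have hsub : Icc (0:ℝ) 1 ⊆ Ioo a b := fun x hx => ⟨ha.trans_le hx.1, hx.2.trans_lt hb⟩
  -- integer multiplicities
  obtain ⟨D, F, hD, hF⟩ := exists_int_mul_eq f
  have hD0 : (D : ℝ) ≠ 0 := by exact_mod_cast hD.ne'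
  -- the complex affine functions `w_k`
  set W : Fin A → ℝ → ℂ := fun k x => (1 : ℂ) - ((p k : ℂ) + (q k : ℂ) * I) * (x : ℂ) with hW
  obtain ⟨m, T, hTs, hTa, hT⟩ := KZ.DilationArctanSector.exists_nash_arctan_eq_sum_arg hI W
    (fun k => isSemialgebraicFunOn_w_re hI (hp k)) (fun k => isSemialgebraicFunOn_w_im hI (hq k))
    (fun k x _ => analyticAt_w_re (p k) (q k) x) (fun k x _ => analyticAt_w_im (p k) (q k) x)
    (fun k x hx => w_mem_slitPlane (hslit k x hx)) F
  -- `T(0) = 0`, `T(1) = 0`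
  have hT0 : T 0 = 0 := by
    have h := hT 0 h0I
    have h0 : ∑ k, (F k : ℝ) * Complex.arg (W k 0) = 0 := by
      refine Finset.sum_eq_zero fun k _ => ?_
      simp [hW]
    rw [h0, zero_div] at h
    exact Real.arctan_eq_zero_iff.mp h
  have hT1 : T 1 = 0 := by
    have h := hT 1 h1I
    have h1 : ∑ k, (F k : ℝ) * Complex.arg (W k 1) = 0 := by
      have : ∑ k, (F k : ℝ) * Complex.arg (W k 1) =
          (D : ℝ) * ∑ k, (f k : ℝ) * Complex.arg (W k 1) := by
        rw [Finset.mul_sum]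
        exact Finset.sum_congr rfl fun k _ => by rw [hF k]; ring
      rw [this, hrel, mul_zero]
    rw [h1, zero_div] at h
    exact Real.arctan_eq_zero_iff.mp h
  -- the derivative identity `ψ = (2^{m+1}/D) · (arctan T)'` on `(a,b)`
  set ψ : ℝ → ℝ := fun x => ∑ k, (f k : ℝ) * (-q k / ((1 - p k * x) ^ 2 + (q k * x) ^ 2)) with hψ
  have hψ_eq : ∀ x ∈ Ioo a b, ψ x = (2 ^ (m + 1) / (D : ℝ)) * (deriv T x / (1 + T x ^ 2)) := by
    intro x hx
    -- derivative of `arctan ∘ T`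
    have h1 : HasDerivAt (fun y => Real.arctan (T y)) (deriv T x / (1 + T x ^ 2)) x := by
      have h := ((hTa x hx).differentiableAt.hasDerivAt).arctan
      refine h.congr_deriv ?_
      ring
    -- derivative of `Θ/2^{m+1}`, `Θ = Σ F_k arg w_k`
    have h2 : HasDerivAt (fun y => (∑ k, (F k : ℝ) * Complex.arg (W k y)) / 2 ^ (m + 1))
        ((∑ k, (F k : ℝ) * (-q k / ((1 - p k * x) ^ 2 + (q k * x) ^ 2))) / 2 ^ (m + 1)) x := by
      refine HasDerivAt.div_const ?_ _
      exact HasDerivAt.fun_sum fun k _ => (hasDerivAt_arg_w (hslit k x hx)).const_mul _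
    -- the two functions agree near `x`
    have h3 : HasDerivAt (fun y => Real.arctan (T y))
        ((∑ k, (F k : ℝ) * (-q k / ((1 - p k * x) ^ 2 + (q k * x) ^ 2))) / 2 ^ (m + 1)) x := by
      refine h2.congr_of_eventuallyEq ?_
      filter_upwards [Ioo_mem_nhds hx.1 hx.2] with y hy
      exact hT y hy
    have h4 := h1.unique h3
    have hsumF : ∑ k, (F k : ℝ) * (-q k / ((1 - p k * x) ^ 2 + (q k * x) ^ 2)) = (D : ℝ) * ψ x := by
      rw [hψ, Finset.mul_sum]
      exact Finset.sum_congr rfl fun k _ => by rw [hF k]; ring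
    rw [h4, hsumF]
    have h2pow : (2 : ℝ) ^ (m + 1) ≠ 0 := by positivity
    field_simp
  -- the arctangent sector lift, rescaled
  obtain ⟨K, V, hVo, hVc, hKs, hKa, hid⟩ := KZ.dilationArctanSector_lift ha hb hTs hTa hT0 hT1
  have hcoef : IsAlgebraic ℚ (2 ^ (m + 1) / (D : ℝ)) := by
    have : (2 ^ (m + 1) / (D : ℝ)) = ((2 ^ (m + 1) / D : ℚ) : ℝ) := by push_cast; ring
    rw [this]; exact isAlgebraic_algebraMap _
  have hVs : IsSemialgebraic ℚ V := IsSemialgebraicFunOn.isSemialgebraic_holds hKs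
  refine ⟨fun p => (2 ^ (m + 1) / (D : ℝ)) * K p, V, hVo, hVc,
    (isSemialgebraicFunOn_const_of_isAlgebraic hVs hcoef).fun_mul hKs,
    fun p hp => analyticAt_const.mul (hKa p hp), fun ϖ hϖ => ?_⟩
  -- the identity: replace `ψ` by `(2^{m+1}/D)(arctan T)'` on the cube, then use the lift
  have hcong : (∫ z in Set.pi Set.univ (fun _ : Fin 1 => Icc (0:ℝ) 1), ψ ((ϖ • z) 0)) =
      ∫ z in Set.pi Set.univ (fun _ : Fin 1 => Icc (0:ℝ) 1),
        (2 ^ (m + 1) / (D : ℝ)) * (deriv T ((ϖ • z) 0) / (1 + T ((ϖ • z) 0) ^ 2)) := by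
    refine setIntegral_congr_fun (MeasurableSet.univ_pi fun _ => measurableSet_Icc) fun z hz => ?_
    have hz0 : z 0 ∈ Icc (0:ℝ) 1 := (Set.mem_univ_pi.mp hz) 0
    refine hψ_eq _ (hsub ⟨?_, ?_⟩)
    · simpa using mul_nonneg hϖ.1 hz0.1
    · simpa using mul_le_one₀ hϖ.2 hz0.1 hz0.2
  calc (∫ z in Set.pi Set.univ (fun _ : Fin 1 => Icc (0:ℝ) 1),
          ∑ k, (f k : ℝ) * (-q k / ((1 - p k * ((ϖ • z) 0)) ^ 2 + (q k * ((ϖ • z) 0)) ^ 2)))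
        = ∫ z in Set.pi Set.univ (fun _ : Fin 1 => Icc (0:ℝ) 1), ψ ((ϖ • z) 0) := by
          simp only [hψ]
    _ = (2 ^ (m + 1) / (D : ℝ)) * ∫ z in Set.pi Set.univ (fun _ : Fin 1 => Icc (0:ℝ) 1),
          (deriv T ((ϖ • z) 0) / (1 + T ((ϖ • z) 0) ^ 2)) := by rw [hcong, integral_const_mul]
    _ = (2 ^ (m + 1) / (D : ℝ)) * ((ϖ - 1) * ∫ y in Set.pi Set.univ (fun _ : Fin 1 => Icc (0:ℝ) 1),
          K (Matrix.vecCons ϖ (ϖ • y))) := by rw [hid ϖ hϖ]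
    _ = (ϖ - 1) * ∫ y in Set.pi Set.univ (fun _ : Fin 1 => Icc (0:ℝ) 1),
          (2 ^ (m + 1) / (D : ℝ)) * K (Matrix.vecCons ϖ (ϖ • y)) := by
          rw [integral_const_mul]; ring

end KZ.BakerSectorComplex

end Literature.NumberTheory.Transcendental
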